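/-
Copyright (c) 2026 the pub-hodgecm-mathlib formalisation cell (harness21).  Prover seat hodgecm-mathlib-F0P3a-p01 (g18): road «S3-ram» (LEAD F0P3a-plan (g13);
owner F0P3a-p06), (Cnt2′) route B (chair F0P3a-p07 (g15) RULING (13)), organ (4c) «THE ROOT REGION OF THE HYPERBOLIC BLOCK LITERAL LIES ON THE AXIS»; 2026-09-02.
-/
import Literature.NumberTheory.Automorphic.UnitaryLatticeTreeAnisotropicBlockRootRegion   -- ★ p848920 (F0P3a-p08 (g20)): `endoGL_sub_smul_one_mulVec_eq`, `forall_mulVec_mem_scaleLattice_of_map_le`; brings ★ TubeCone ∕ TubeCoordinate ∕ TubeAxisVertex ∕ TubeCollarTokens ∕ AxisEndoFrame(Basis)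
import Literature.NumberTheory.Automorphic.UnitaryLatticeTreeAxisCountTransport           -- ★ p847852 (F0P3a-p07 (g14)): `ncard_selfDual_fixed_axis_lev_eq`
import Literature.NumberTheory.Automorphic.UnitaryLatticeTreeCentralRescalingCountTransport -- ★ (F0P3a-p05 (g17)): `v_pairing_self_le_one`
import HarnessLib

/-!
# The lattice graph of a hermitian space — a self-dual lattice of root level `ϖ^{d₀}` for a block literal `ι(γ₂, u)` lies ON THE AXIS as soon as
# `|det(γ₂ − u₀₀·1)| > |ϖ|^{2d₀+1}` (Bruhat–Tits 1972 §10; Kottwitz 1986 §3)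

Topic `NumberTheory/Automorphic`; namespace `Literature.NumberTheory.Automorphic.UnitaryLatticeTree`.  THEOREMS ONLY (no definition, no instance, no notation, no named fact,
no `sorry`); kernel lane `--supports stmt-HodgeConjecture-24833`; datum-free (`K` with `Valued K ℤᵐ⁰`; `[IsPrincipalIdealRing 𝒪[K]]` for the axis-vertex basis, discharged
downstream by ★ `isPrincipalIdealRing_integer_adicCompletion`).  Cell `pub/hodgecm-mathlib` (D-0151), crux H413; road «S3-ram» (Literature seeding, count-neutral); (Cnt2′) route B,
organ **(4c)** (heir chair F0P3a-p07 (g15) RULING (13); (α) keeper F0P3a-p06 (g16) v1): the `sR` of ★ `strataCount_J₀_block_raw` (F0P2-p02 (g14)) at the HYPERBOLIC type-(2)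
literal `ι(g_w, u_w)` in REGIME B (`d₀ = d_u = m`, `|χ_{g_w}(u_w)|_w = |ϖ_w|^{2m}`) consists of AXIS vertices `B ⊕ 𝒪e₁` only — what the kind-keyed pooling (4a) (F0P3-p03 (g16))
and the per-kind values (4b) (A-p12 (g25)) over A-p12's ★ W-ball presuppose.  Twin of ★ p848920 THM 1 (F0P3a-p08 (g20), the anisotropic literal, `R = {r₀}`).

THE MATHEMATICS.  Block model `H = ι-shape(H₂, h)` (ANY unit-det `H₂`, `|h| = 1`), `Γ = ι(γ₂, u)`, `T := γ₂ − u₀₀·1`.  Let `M` be self-dual with `(Γ − 1)·M ≤ ϖ^{d₀}·M`; it has a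
tube coordinate `b` (★ `exists_tubeCoordinate`) and an axis vertex `A(M) = (M ∩ W) + ϖ^b·M + 𝒪e₁ = latt ι(g₂, 1)` with `latt g₂` self-dual for `H₂` (★ `exists_axisVertex_eq_latt_endoGL`).
(§1) The level passes to the axis vertex: `(Γ − 1)·A(M) ≤ ϖ^{d₀}·A(M)` (piece by piece; the `𝒪e₁`-piece needs `|u₀₀ − 1| ≤ |ϖ|^{d₀}`, which ★ (c3-i) reads off `M` itself), so
in the basis `g₂` the `W`-block `T′ := g₂⁻¹·T·g₂` has all entries in `ϖ^{d₀}𝒪`.  (§2) If `b ≥ 1`, ★ (c3-iv′) `forall_mulVec_mem_scaleLattice_iff_of_cone` (`S := Γ − 1`,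
`c := ϖ^{d₀}`, `S − S₁₁·1 = Γ − u₀₀·1`, ★ `endoGL_sub_smul_one_mulVec_eq`) gives `(Γ − u₀₀·1)z = ι(T z_W, 0) ∈ ϖ^{b+d₀}·A(M)` for `z = ϖ^b·pr_W x₀` (the unit-norm generator of
the glue line, ★ `cone_anatomy_of_tubeCoordinate`): so `y := g₂⁻¹ z_W ∈ 𝒪²` has a UNIT coordinate (unit norm) and `T′y ∈ ϖ^{d₀+b}𝒪² ⊆ ϖ^{d₀+1}𝒪²`.  The adjugate identity
`det T′ · y = adj(T′)·(T′y)` then forces `|det T| = |det T′| ≤ |ϖ|^{2d₀+1}`.  Hence **`|det(γ₂ − u₀₀·1)| > |ϖ|^{2d₀+1}` ⇒ `b = 0`, i.e. `e₁ ∈ M`: THE ROOT REGION LIES ON THE AXIS**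
(§2 `single_one_one_mem_of_selfDual_lev_of_lt_v_det`), the root region set gains the conjunct `e₁ ∈ M` for free (§3 `setOf_selfDual_fixed_lev_eq_setOf_axis_of_lt_v_det`) and its
count is the `W`-side count `#{B ∣ SD_{H₂} B ∧ γ₂B = B ∧ (γ₂ − 1)B ≤ ϖ^{d₀}B}` (★ `ncard_selfDual_fixed_axis_lev_eq`; §3 `ncard_selfDual_fixed_lev_eq_ncard_two_of_lt_v_det`).
DICTIONARY (socket of record, (α) v0∕v1): at the hyperbolic literal `T = g_w − u_w·1`, `det T = χ_{g_w}(u_w)`, `|χ_{g_w}(u_w)|_w = |ϖ_w|^{2m}` (`hm`), so the premise reads `m ≤ d₀`;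
in REGIME B `d₀ = d_u = m` (B-p14 (g40) LEDGER: `V = m = min(N, d_u)` 164∕164; `#R = m0(N − 2k_u)` = the W-ball — no tube members).  HONEST CAVEAT: in REGIME A (`m = N > d₀ = d_{γ₂}`)
the premise FAILS and the axis conclusion needs the isotropic-kernel argument instead (sequel); rooted OFF-centre (B-p14's caveat row, `d₀ = 3 < d_u = 5 = m`) it fails and `R` does
spill into the tube.
HONEST LABEL: HC_CM is proved only modulo the 2 remaining named inputs (hLiu418 24832, h413 24833) until rung 0 closes; nothing printed is asserted here (elementary lattice
bookkeeping); «S3-ram» has no books consequence.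

## References
* [BruhatTits1972] F. Bruhat, J. Tits, *Groupes réductifs sur un corps local I*, Publ. Math. IHÉS 41 (1972), §10 (lattice models of the building; the axis of a Levi block).
* [Kottwitz1986] R. E. Kottwitz, *Base change for unit elements of Hecke algebras*, Compositio Math. 60 (1986), §3 (fixed lattices of a block element, counted along the axis).
* [Serre1980Trees] J.-P. Serre, *Trees* (1980), Ch. II §1.1 (lattices, distance, the geodesic to a sub-lattice).
* [Rogawski1990] J. D. Rogawski, *Automorphic Representations of Unitary Groups in Three Variables*, Ann. of Math. Stud. 123 (1990), §4.8 Case (a) p. 53, §4.9 pp. 54–56.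
-/

set_option autoImplicit false

noncomputable section

open scoped Valued WithZero Matrix MatrixGroups

namespace Literature.NumberTheory.Automorphic.UnitaryLatticeTree

open Literature.NumberTheory.Automorphic Literature.NumberTheory.Automorphic.HermitianLattice Literature.NumberTheory.Rogawski1990

variable {K : Type*} [Field K] [Valued K ℤᵐ⁰]

/-! ## §1 The root level passes from `M` to its axis vertex `A(M)` -/

omit [Valued K ℤᵐ⁰] in
/-- The `1`-coordinate of `(Γ − 1)·x` is `(u₀₀ − 1)·x₁` for the block element `Γ = ι(γ₂, u)`. [cite: Rogawski1990, §4.8 Case (a) p. 53] -/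
theorem endoGL_sub_one_mulVec_apply_one (γ₂ : GL (Fin 2) K) (u : GL (Fin 1) K) (x : Fin 3 → K) :
    ((((endoGL (γ₂, u) : GL (Fin 3) K) : Matrix (Fin 3) (Fin 3) K) - 1) *ᵥ x) 1 = ((u : Matrix (Fin 1) (Fin 1) K) 0 0 - 1) * x 1 := by
  rw [coe_endoGL_sub_one_eq_endoShape]
  simp [Matrix.mulVec, dotProduct, Fin.sum_univ_three]

set_option maxHeartbeats 800000 in -- budget only: statement-heavy block tokens.
/-- **THE ROOT LEVEL PASSES TO THE AXIS VERTEX.**  Block form `ι-shape(H₂, h)`, `Γ = ι(γ₂, u)`, `M` with tube coordinate `b` and axis vertex `A(M) = (M ∩ W) + ϖ^b·M + 𝒪e₁`.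
If `(Γ − 1)·M ≤ c·M` (pointwise) and `|u₀₀ − 1| ≤ |c|` then `(Γ − 1)·A(M) ≤ c·A(M)` (pointwise) — each of the three pieces of `A(M)` is mapped into `c·` itself: `(Γ − 1)(M ∩ W) ⊆
c·M ∩ W = c·(M ∩ W)` (the `1`-row of `Γ − 1` is `(u₀₀ − 1)·e₁ᵀ`), `(Γ − 1)(ϖ^b M) = ϖ^b (Γ − 1)M ⊆ c·ϖ^b M`, `(Γ − 1)e₁ = (u₀₀ − 1)e₁ ∈ c·𝒪e₁`.  (The hypothesis shape `hAlev` of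
★ `collar_fixed_and_lev_of_axisLevel`.) [cite: Kottwitz1986, §3] [cite: BruhatTits1972, §10] [cite: Serre1980Trees, Ch. II §1.1] -/
theorem forall_mulVec_mem_scaleLattice_axisVertex_of_forall {ϖ : K} (hϖ0 : ϖ ≠ 0) (M : Submodule 𝒪[K] (Fin 3 → K)) (b : ℕ)
    (γ₂ : GL (Fin 2) K) (u : GL (Fin 1) K) {c : K} (hc : c ≠ 0)
    (hu : Valued.v ((u : Matrix (Fin 1) (Fin 1) K) 0 0 - 1) ≤ Valued.v c)
    (hlev : ∀ x ∈ M, (((endoGL (γ₂, u) : GL (Fin 3) K) : Matrix (Fin 3) (Fin 3) K) - 1) *ᵥ x ∈ scaleLattice c M) :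
    ∀ a ∈ M ⊓ LinearMap.ker ((LinearMap.proj (1 : Fin 3) : (Fin 3 → K) →ₗ[K] K).restrictScalars 𝒪[K]) ⊔ scaleLattice (ϖ ^ b) M ⊔ Submodule.span 𝒪[K] {(Pi.single 1 1 : Fin 3 → K)},
      (((endoGL (γ₂, u) : GL (Fin 3) K) : Matrix (Fin 3) (Fin 3) K) - 1) *ᵥ a ∈
        scaleLattice c (M ⊓ LinearMap.ker ((LinearMap.proj (1 : Fin 3) : (Fin 3 → K) →ₗ[K] K).restrictScalars 𝒪[K]) ⊔ scaleLattice (ϖ ^ b) M ⊔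
          Submodule.span 𝒪[K] {(Pi.single 1 1 : Fin 3 → K)}) := by
  have hvc : Valued.v c ≠ 0 := (Valuation.ne_zero_iff _).2 hc
  set S : Matrix (Fin 3) (Fin 3) K := ((endoGL (γ₂, u) : GL (Fin 3) K) : Matrix (Fin 3) (Fin 3) K) - 1 with hSdef
  set MW : Submodule 𝒪[K] (Fin 3 → K) := M ⊓ LinearMap.ker ((LinearMap.proj (1 : Fin 3) : (Fin 3 → K) →ₗ[K] K).restrictScalars 𝒪[K]) with hMWdef
  set A : Submodule 𝒪[K] (Fin 3 → K) := MW ⊔ scaleLattice (ϖ ^ b) M ⊔ Submodule.span 𝒪[K] {(Pi.single 1 1 : Fin 3 → K)} with hAdef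
  have hMWA : MW ≤ A := le_sup_left.trans le_sup_left
  have hbA : scaleLattice (ϖ ^ b) M ≤ A := le_sup_right.trans le_sup_left
  have heA : Submodule.span 𝒪[K] {(Pi.single 1 1 : Fin 3 → K)} ≤ A := le_sup_right
  -- piece 1: `M ∩ W`
  have h1 : ∀ a ∈ MW, S *ᵥ a ∈ scaleLattice c A := by
    intro a ha
    obtain ⟨haM, haW⟩ := Submodule.mem_inf.1 ha
    have ha1 : a 1 = 0 := by simpa using haW
    have hSa : S *ᵥ a ∈ scaleLattice c M := hlev a haM
    rw [mem_scaleLattice_iff hc] at hSa ⊢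
    refine hMWA (Submodule.mem_inf.2 ⟨hSa, ?_⟩)
    simp only [LinearMap.mem_ker, LinearMap.coe_restrictScalars, LinearMap.coe_proj, Function.eval, Pi.smul_apply, smul_eq_mul]
    rw [hSdef, endoGL_sub_one_mulVec_apply_one, ha1, mul_zero, mul_zero]
  -- piece 2: `ϖ^b M`
  have h2 : ∀ a ∈ scaleLattice (ϖ ^ b) M, S *ᵥ a ∈ scaleLattice c A := by
    intro a ha
    have hϖb : ϖ ^ b ≠ 0 := pow_ne_zero _ hϖ0
    rw [mem_scaleLattice_iff hϖb] at ha
    have hSa := hlev _ ha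
    rw [Matrix.mulVec_smul, mem_scaleLattice_iff hc, smul_comm] at hSa
    rw [mem_scaleLattice_iff hc]
    exact hbA ((mem_scaleLattice_iff hϖb _ _).2 hSa)
  -- piece 3: `𝒪e₁`
  have h3 : ∀ a ∈ Submodule.span 𝒪[K] {(Pi.single 1 1 : Fin 3 → K)}, S *ᵥ a ∈ scaleLattice c A := by
    intro a ha
    obtain ⟨t, rfl⟩ := Submodule.mem_span_singleton.1 ha
    have hSe : S *ᵥ (Pi.single 1 1 : Fin 3 → K) = ((u : Matrix (Fin 1) (Fin 1) K) 0 0 - 1) • (Pi.single 1 1 : Fin 3 → K) := by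
      rw [hSdef, coe_endoGL_sub_one_eq_endoShape]
      ext i; fin_cases i <;> simp [Matrix.mulVec, dotProduct, Fin.sum_univ_three]
    rw [show (t • (Pi.single 1 1 : Fin 3 → K)) = ((t : K) • (Pi.single 1 1 : Fin 3 → K)) from rfl, Matrix.mulVec_smul, hSe, smul_smul,
      mem_scaleLattice_iff hc, smul_smul]
    refine heA (smul_mem_of_v_le _ ?_ (Submodule.mem_span_singleton_self _))
    rw [map_mul, map_mul, map_inv₀, mul_comm (Valued.v (t : K)), ← mul_assoc]
    refine mul_le_one' ?_ ((mem_integer_iff' _).1 t.2)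
    rw [inv_mul_le_iff₀ (zero_lt_iff.2 hvc), mul_one]; exact hu
  -- assemble
  intro a ha
  obtain ⟨y, hy, e, he, rfl⟩ := Submodule.mem_sup.1 ha
  obtain ⟨w, hw, s, hs, rfl⟩ := Submodule.mem_sup.1 hy
  rw [Matrix.mulVec_add, Matrix.mulVec_add]
  exact Submodule.add_mem _ (Submodule.add_mem _ (h1 w hw) (h2 s hs)) (h3 e he)

/-! ## §2 Off the axis the determinant of `T = γ₂ − u₀₀·1` is forced below `ϖ^{2d₀+1}` -/

omit [Valued K ℤᵐ⁰] in
/-- Projecting an `ι`-shaped vector of `K³` to `W = ⟨e₀, e₂⟩` commutes with scalars: `((c • ι(v, 0))₀, (c • ι(v, 0))₂) = c • v`. [cite: Serre1980Trees, Ch. II §1.1] -/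
theorem vecTwo_smul_vecThree_eq (c : K) (v : Fin 2 → K) :
    (![(c • (![v 0, (0 : K), v 1] : Fin 3 → K)) 0, (c • (![v 0, (0 : K), v 1] : Fin 3 → K)) 2] : Fin 2 → K) = c • v := by
  ext i; fin_cases i <;> simp

omit [Valued K ℤᵐ⁰] in
/-- `⟨a·x, a·y⟩ = σ(a)·a·⟨x, y⟩` (sesquilinearity). [cite: Jacobowitz1962, §4] -/
theorem pairing_smul_smul {N : ℕ} (σ : K →+* K) (H : Matrix (Fin N) (Fin N) K) (a : K) (x y : Fin N → K) :
    pairing σ H (a • x) (a • y) = σ a * (a * pairing σ H x y) := by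
  rw [LinearMap.map_smulₛₗ (pairing σ H) a x, LinearMap.smul_apply, LinearMap.map_smul, smul_eq_mul, smul_eq_mul]

/-- A `2 × 2` matrix with entries in `c·𝒪` that contracts a vector with a UNIT coordinate into `(c·t)·𝒪²` has `|det| ≤ |c|·|c·t|`: the adjugate identity
`det P · y = adj(P)·(P·y)` read at the unit coordinate. [cite: Serre1980Trees, Ch. II §1.1] -/
theorem v_det_le_of_entries_le_of_mulVec_le (P : Matrix (Fin 2) (Fin 2) K) {c r : ℤᵐ⁰} (hP : ∀ i k, Valued.v (P i k) ≤ c)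
    {y : Fin 2 → K} {i₀ : Fin 2} (hy : Valued.v (y i₀) = 1) (hPy : ∀ i, Valued.v ((P *ᵥ y) i) ≤ r) :
    Valued.v P.det ≤ c * r := by
  have hadj : P.det • y = P.adjugate *ᵥ (P *ᵥ y) := by
    rw [Matrix.mulVec_mulVec, Matrix.adjugate_mul, Matrix.smul_mulVec, Matrix.one_mulVec]
  have hadj_ent : ∀ i k, Valued.v (P.adjugate i k) ≤ c := by
    intro i k
    rw [Matrix.adjugate_fin_two]
    fin_cases i <;> fin_cases k
    · simpa using hP 1 1
    · simpa using hP 0 1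
    · simpa using hP 1 0
    · simpa using hP 0 0
  have key : ∀ v : Fin 2 → K, (∀ i, Valued.v (v i) ≤ r) → Valued.v ((P.adjugate *ᵥ v) i₀) ≤ c * r := by
    intro v hv
    simp only [Matrix.mulVec, dotProduct, Fin.sum_univ_two]
    refine (Valuation.map_add _ _ _).trans (max_le ?_ ?_)
    · rw [map_mul]; exact mul_le_mul' (hadj_ent i₀ 0) (hv 0)
    · rw [map_mul]; exact mul_le_mul' (hadj_ent i₀ 1) (hv 1)
  have e := congrFun hadj i₀
  rw [Pi.smul_apply, smul_eq_mul] at e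
  have h : Valued.v (P.det * y i₀) ≤ c * r := by rw [e]; exact key _ hPy
  rwa [map_mul, hy, mul_one] at h

set_option maxHeartbeats 1600000 in -- budget only: statement-heavy block tokens and the ★ cone lemma's four-clause output.
/-- **THM 1 — A SELF-DUAL LATTICE OF ROOT LEVEL FOR THE BLOCK LITERAL LIES ON THE AXIS.**  Block model `ι-shape(H₂, h)` (any unit-det hermitian `H₂`, `|h| = 1`, `σh = h`),
`Γ = ι(γ₂, u)`, `T := γ₂ − u₀₀·1`.  If `|det T| > |ϖ|^{2d₀+1}` then every self-dual `M` with `(Γ − 1)·M ≤ ϖ^{d₀}·M` contains `e₁` (tube coordinate `b = 0`: `M = (M ∩ W) ⊕ 𝒪e₁` is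
an AXIS vertex).  At the hyperbolic type-(2) literal of the (Cnt2′) block law `det T = χ_{g_w}(u_w)` has `|·|_w = |ϖ_w|^{2m}`, so the premise is `m ≤ d₀` — REGIME B (`d₀ = d_u = m`).
No fixedness, no ellipticity, no parity is used. [cite: Kottwitz1986, §3] [cite: BruhatTits1972, §10] [cite: Rogawski1990, §4.9 pp. 54–56] -/
theorem single_one_one_mem_of_selfDual_lev_of_lt_v_det [IsPrincipalIdealRing 𝒪[K]] (σ : K →+* K) (hσ : ∀ a, σ (σ a) = a)
    (hvσ : ∀ a, Valued.v (σ a) = Valued.v a) {ϖ : K} (hϖ : Valued.v ϖ = WithZero.exp (-1 : ℤ))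
    {H₂ : Matrix (Fin 2) (Fin 2) K} (hH₂ : IsUnit H₂.det) (hH₂σ : (H₂.map σ)ᵀ = H₂) {h : K} (hh : Valued.v h = 1) (hhσ : σ h = h)
    (γ₂ : GL (Fin 2) K) (u : GL (Fin 1) K) {d₀ : ℕ}
    (hdet : Valued.v ϖ ^ (2 * d₀ + 1) <
      Valued.v (((γ₂ : Matrix (Fin 2) (Fin 2) K) - (u : Matrix (Fin 1) (Fin 1) K) 0 0 • (1 : Matrix (Fin 2) (Fin 2) K)).det))
    {M : Submodule 𝒪[K] (Fin 3 → K)}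
    (hM : IsSelfDualLattice σ ϖ (!![H₂ 0 0, 0, H₂ 0 1; 0, h, 0; H₂ 1 0, 0, H₂ 1 1] : Matrix (Fin 3) (Fin 3) K) M)
    (hlev : ∀ x ∈ M, ((((endoGL (γ₂, u) : GL (Fin 3) K) : Matrix (Fin 3) (Fin 3) K) - 1) *ᵥ x) ∈ scaleLattice (ϖ ^ d₀) M) :
    (Pi.single 1 1 : Fin 3 → K) ∈ M := by
  have hϖ0' : Valued.v ϖ ≠ 0 := by rw [hϖ]; exact WithZero.exp_ne_zero
  have hϖ0 : ϖ ≠ 0 := fun h0 => by rw [h0, map_zero] at hϖ0'; exact hϖ0' rfl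
  have hϖ1 : Valued.v ϖ < 1 := by rw [hϖ, ← WithZero.exp_zero]; exact WithZero.exp_lt_exp.2 (by norm_num)
  have hc : (ϖ ^ d₀ : K) ≠ 0 := pow_ne_zero _ hϖ0
  obtain ⟨b, hb, -, x₀, hx₀, hx₀1⟩ := exists_tubeCoordinate σ hvσ hϖ hH₂ hh hM
  rcases Nat.eq_zero_or_pos b with rfl | hb1
  · exact (hb 1).2 (by rw [map_one, pow_zero])
  exfalso
  set T : Matrix (Fin 2) (Fin 2) K := (γ₂ : Matrix (Fin 2) (Fin 2) K) - (u : Matrix (Fin 1) (Fin 1) K) 0 0 • (1 : Matrix (Fin 2) (Fin 2) K) with hTdef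
  obtain ⟨g₂, hSD₂, hA, -⟩ := exists_axisVertex_eq_latt_endoGL σ hσ hvσ hϖ hH₂ hH₂σ hh hhσ hM hb
  have hcol : ∀ l : Fin 3, l ≠ 1 → ((((endoGL (γ₂, u) : GL (Fin 3) K) : Matrix (Fin 3) (Fin 3) K) - 1)) l 1 = 0 := fun l hl => endoGL_sub_one_col γ₂ u l hl
  have hrow : ∀ l : Fin 3, l ≠ 1 → ((((endoGL (γ₂, u) : GL (Fin 3) K) : Matrix (Fin 3) (Fin 3) K) - 1)) 1 l = 0 := fun l hl => endoGL_sub_one_row γ₂ u l hl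
  obtain ⟨h11, -, hgen, -⟩ := (forall_mulVec_mem_scaleLattice_iff_of_cone σ hvσ hϖ hH₂ hh hM hb1 hb hx₀ hx₀1 hcol hrow hc).1 hlev
  rw [endoGL_sub_one_apply_one_one] at h11
  -- (§1) the level at the axis vertex, read in the basis `g₂`
  have hAlev := forall_mulVec_mem_scaleLattice_axisVertex_of_forall hϖ0 M b γ₂ u hc h11 hlev
  rw [← hA] at hAlev
  have hAmap : (latt ((endoGL (g₂, (1 : GL (Fin 1) K)) : GL (Fin 3) K) : Matrix (Fin 3) (Fin 3) K)).map
        ((Matrix.toLin' (((endoGL (γ₂, u) : GL (Fin 3) K) : Matrix (Fin 3) (Fin 3) K) - 1)).restrictScalars 𝒪[K]) ≤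
      scaleLattice (ϖ ^ d₀) (latt ((endoGL (g₂, (1 : GL (Fin 1) K)) : GL (Fin 3) K) : Matrix (Fin 3) (Fin 3) K)) :=
    Submodule.map_le_iff_le_comap.2 fun a ha => hAlev a ha
  obtain ⟨hWmap, -⟩ := (map_endoGL_sub_one_latt_endoGL_le_scaleLattice_iff hc g₂ γ₂ u).1 hAmap
  have hent := (map_sub_one_latt_le_scaleLattice_iff hc γ₂ g₂).1 hWmap
  have hg : IsUnit (g₂ : Matrix (Fin 2) (Fin 2) K).det := Matrix.isUnits_det_units _
  have hginv : ((g₂⁻¹ : GL (Fin 2) K) : Matrix (Fin 2) (Fin 2) K) = (g₂ : Matrix (Fin 2) (Fin 2) K)⁻¹ := Matrix.coe_units_inv g₂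
  -- `T′ := g₂⁻¹ T g₂ = (g₂⁻¹γ₂g₂ − 1) − (u₀₀ − 1)·1` has entries in `ϖ^{d₀}𝒪`
  set T' : Matrix (Fin 2) (Fin 2) K := ((g₂⁻¹ : GL (Fin 2) K) : Matrix (Fin 2) (Fin 2) K) * T * (g₂ : Matrix (Fin 2) (Fin 2) K) with hT'def
  have hT'eq : T' = (((g₂⁻¹ * γ₂ * g₂ : GL (Fin 2) K) : Matrix (Fin 2) (Fin 2) K) - 1) -
      ((u : Matrix (Fin 1) (Fin 1) K) 0 0 - 1) • (1 : Matrix (Fin 2) (Fin 2) K) := by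
    have hgg : ((g₂⁻¹ : GL (Fin 2) K) : Matrix (Fin 2) (Fin 2) K) * (g₂ : Matrix (Fin 2) (Fin 2) K) = 1 := by
      rw [← Units.val_mul, inv_mul_cancel, Units.val_one]
    rw [hT'def, hTdef, Units.val_mul, Units.val_mul, Matrix.mul_sub, Matrix.sub_mul, Matrix.mul_smul, Matrix.mul_one, Matrix.smul_mul, hgg, sub_smul,
      one_smul]
    abel
  have hT'ent : ∀ i k, Valued.v (T' i k) ≤ Valued.v (ϖ ^ d₀) := by
    intro i k
    rw [hT'eq, Matrix.sub_apply, Matrix.smul_apply, smul_eq_mul]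
    refine (Valuation.map_sub _ _ _).trans (max_le (hent i k) ?_)
    by_cases hik : i = k
    · rw [hik, Matrix.one_apply_eq, mul_one]; exact h11
    · rw [Matrix.one_apply_ne hik, mul_zero, map_zero]; exact zero_le
  -- (§2) the unit-norm generator of the glue line and its `W`-coordinates `y` in the basis `g₂`
  obtain ⟨hzA, hzz, -, -⟩ := cone_anatomy_of_tubeCoordinate σ hvσ hϖ hH₂ hh hM hb1 hb hx₀ hx₀1
  set z : Fin 3 → K := (ϖ ^ b) • (x₀ - Pi.single 1 (x₀ 1)) with hzdef
  have hz1 : z 1 = 0 := by simp [hzdef]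
  rw [← hA, mem_latt_endoGL_one_iff] at hzA
  obtain ⟨hzW, -⟩ := hzA
  rw [pairing_endoShape_apply, hz1, map_zero, zero_mul, zero_mul, add_zero] at hzz
  set zW : Fin 2 → K := ![z 0, z 2] with hzWdef
  set y : Fin 2 → K := (g₂ : Matrix (Fin 2) (Fin 2) K)⁻¹ *ᵥ zW with hydef
  have hy : ∀ i, Valued.v (y i) ≤ 1 := mem_stdLattice.1 ((mem_latt_iff_of_isUnit hg zW).1 hzW)
  have hzWy : zW = (g₂ : Matrix (Fin 2) (Fin 2) K) *ᵥ y := by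
    rw [hydef, Matrix.mulVec_mulVec, Matrix.mul_nonsing_inv _ hg, Matrix.one_mulVec]
  -- unit norm ⇒ a unit coordinate
  have hprim : ∃ i, Valued.v (y i) = 1 := by
    by_contra hne
    have hne' : ∀ i, Valued.v (y i) ≠ 1 := fun i hi => hne ⟨i, hi⟩
    have hlt : ∀ i, Valued.v (y i) ≤ Valued.v ϖ := fun i => by
      rw [hϖ]; exact (v_lt_one_iff (y i)).1 (lt_of_le_of_ne (hy i) (hne' i))
    have hy' : ∀ i, Valued.v ((ϖ⁻¹ • y) i) ≤ 1 := fun i => by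
      rw [Pi.smul_apply, smul_eq_mul, map_mul, map_inv₀]
      exact (mul_le_mul' le_rfl (hlt i)).trans (le_of_eq (inv_mul_cancel₀ hϖ0'))
    have hmem : (g₂ : Matrix (Fin 2) (Fin 2) K) *ᵥ (ϖ⁻¹ • y) ∈ latt (g₂ : Matrix (Fin 2) (Fin 2) K) := mulVec_mem_latt _ (mem_stdLattice.2 hy')
    have hle := v_pairing_self_le_one hvσ hSD₂ hmem
    have e : zW = ϖ • ((g₂ : Matrix (Fin 2) (Fin 2) K) *ᵥ (ϖ⁻¹ • y)) := by
      rw [Matrix.mulVec_smul, smul_smul, mul_inv_cancel₀ hϖ0, one_smul, ← hzWy]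
    rw [e, pairing_smul_smul, map_mul, map_mul, hvσ] at hzz
    have hlt1 : Valued.v ϖ * (Valued.v ϖ * Valued.v (pairing σ H₂ ((g₂ : Matrix (Fin 2) (Fin 2) K) *ᵥ (ϖ⁻¹ • y)) ((g₂ : Matrix (Fin 2) (Fin 2) K) *ᵥ (ϖ⁻¹ • y)))) < 1 :=
      mul_lt_one_of_nonneg_of_lt_one_left zero_le hϖ1 (mul_le_one' hϖ1.le hle)
    exact absurd hzz (ne_of_lt hlt1)
  obtain ⟨i₀, hi₀⟩ := hprim
  -- `T′ y` is small: the generator clause of ★ (c3-iv′)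
  rw [endoGL_sub_one_sub_smul_one, endoGL_sub_smul_one_mulVec_eq, ← hA, mem_scaleLattice_iff (mul_ne_zero (pow_ne_zero b hϖ0) hc), mem_latt_endoGL_one_iff,
    vecTwo_smul_vecThree_eq, mem_latt_iff_of_isUnit hg, Matrix.mulVec_smul, mem_stdLattice] at hgen
  obtain ⟨hgenW, -⟩ := hgen
  have hT'y : T' *ᵥ y = (g₂ : Matrix (Fin 2) (Fin 2) K)⁻¹ *ᵥ (T *ᵥ zW) := by
    rw [hT'def, hzWy, ← Matrix.mulVec_mulVec, ← Matrix.mulVec_mulVec, hginv]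
  have hpos : 0 < Valued.v (ϖ ^ b * ϖ ^ d₀) := zero_lt_iff.2 ((Valuation.ne_zero_iff _).2 (mul_ne_zero (pow_ne_zero b hϖ0) hc))
  have hsmall : ∀ i, Valued.v ((T' *ᵥ y) i) ≤ Valued.v (ϖ ^ b * ϖ ^ d₀) := fun i => by
    have hi := hgenW i
    rw [Pi.smul_apply, smul_eq_mul, map_mul, map_inv₀, inv_mul_le_iff₀ hpos, mul_one] at hi
    rw [hT'y]; exact hi
  -- the adjugate bound and `det T′ = det T`
  have hdet' := v_det_le_of_entries_le_of_mulVec_le T' hT'ent hi₀ hsmall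
  have hdetT : T'.det = T.det := by
    rw [hT'def, Matrix.det_mul, Matrix.det_mul, mul_comm (((g₂⁻¹ : GL (Fin 2) K) : Matrix (Fin 2) (Fin 2) K)).det, mul_assoc, ← Matrix.det_mul, ← Units.val_mul,
      inv_mul_cancel, Units.val_one, Matrix.det_one, mul_one]
  rw [hdetT] at hdet'
  simp only [map_mul, map_pow] at hdet'
  have hbd : Valued.v ϖ ^ d₀ * (Valued.v ϖ ^ b * Valued.v ϖ ^ d₀) ≤ Valued.v ϖ ^ (2 * d₀ + 1) := by
    have hb' : Valued.v ϖ ^ b ≤ Valued.v ϖ ^ 1 := pow_le_pow_right_of_le_one' hϖ1.le hb1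
    calc Valued.v ϖ ^ d₀ * (Valued.v ϖ ^ b * Valued.v ϖ ^ d₀) ≤ Valued.v ϖ ^ d₀ * (Valued.v ϖ ^ 1 * Valued.v ϖ ^ d₀) :=
          mul_le_mul' le_rfl (mul_le_mul' hb' le_rfl)
      _ = Valued.v ϖ ^ (2 * d₀ + 1) := by rw [← pow_add, ← pow_add]; congr 1; omega
  exact absurd (hdet'.trans hbd) (not_le.2 hdet)

/-! ## §3 The root region of the block literal: set and count forms (block model), and the `Φ₃`-model vertex form -/

set_option maxHeartbeats 1600000 in -- budget only: statement-heavy block tokens.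
/-- **THM 2 — THE ROOT REGION LIES ON THE AXIS (set form, block model).**  Under `|det(γ₂ − u₀₀·1)| > |ϖ|^{2d₀+1}` the root region `{M ∣ SD ∧ Γ·M = M ∧ (Γ − 1)·M ≤ ϖ^{d₀}·M}`
of `Γ = ι(γ₂, u)` EQUALS its axis part `{M ∣ SD ∧ Γ·M = M ∧ e₁ ∈ M ∧ (Γ − 1)·M ≤ ϖ^{d₀}·M}` (the left set of ★ `ncard_selfDual_fixed_axis_lev_eq`). [cite: Kottwitz1986, §3]
[cite: BruhatTits1972, §10] [cite: Rogawski1990, §4.9 pp. 54–56] -/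
theorem setOf_selfDual_fixed_lev_eq_setOf_axis_of_lt_v_det [IsPrincipalIdealRing 𝒪[K]] (σ : K →+* K) (hσ : ∀ a, σ (σ a) = a)
    (hvσ : ∀ a, Valued.v (σ a) = Valued.v a) {ϖ : K} (hϖ : Valued.v ϖ = WithZero.exp (-1 : ℤ))
    {H₂ : Matrix (Fin 2) (Fin 2) K} (hH₂ : IsUnit H₂.det) (hH₂σ : (H₂.map σ)ᵀ = H₂) {h : K} (hh : Valued.v h = 1) (hhσ : σ h = h)
    (γ₂ : GL (Fin 2) K) (u : GL (Fin 1) K) {d₀ : ℕ}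
    (hdet : Valued.v ϖ ^ (2 * d₀ + 1) <
      Valued.v (((γ₂ : Matrix (Fin 2) (Fin 2) K) - (u : Matrix (Fin 1) (Fin 1) K) 0 0 • (1 : Matrix (Fin 2) (Fin 2) K)).det)) :
    {M : Submodule 𝒪[K] (Fin 3 → K) | IsSelfDualLattice σ ϖ (!![H₂ 0 0, 0, H₂ 0 1; 0, h, 0; H₂ 1 0, 0, H₂ 1 1] : Matrix (Fin 3) (Fin 3) K) M ∧
        mapGL (endoGL (γ₂, u)) M = M ∧
        M.map ((Matrix.toLin' (((endoGL (γ₂, u) : GL (Fin 3) K) : Matrix (Fin 3) (Fin 3) K) - 1)).restrictScalars 𝒪[K]) ≤ scaleLattice (ϖ ^ d₀) M} =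
    {M : Submodule 𝒪[K] (Fin 3 → K) | IsSelfDualLattice σ ϖ (!![H₂ 0 0, 0, H₂ 0 1; 0, h, 0; H₂ 1 0, 0, H₂ 1 1] : Matrix (Fin 3) (Fin 3) K) M ∧
        mapGL (endoGL (γ₂, u)) M = M ∧ (Pi.single 1 1 : Fin 3 → K) ∈ M ∧
        M.map ((Matrix.toLin' (((endoGL (γ₂, u) : GL (Fin 3) K) : Matrix (Fin 3) (Fin 3) K) - 1)).restrictScalars 𝒪[K]) ≤ scaleLattice (ϖ ^ d₀) M} := by
  ext M
  simp only [Set.mem_setOf_eq]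
  constructor
  · rintro ⟨hM, hfix, hlev⟩
    exact ⟨hM, hfix, single_one_one_mem_of_selfDual_lev_of_lt_v_det σ hσ hvσ hϖ hH₂ hH₂σ hh hhσ γ₂ u hdet hM
      (forall_mulVec_mem_scaleLattice_of_map_le _ _ _ hlev), hlev⟩
  · rintro ⟨hM, hfix, -, hlev⟩
    exact ⟨hM, hfix, hlev⟩

set_option maxHeartbeats 1600000 in -- budget only: statement-heavy block tokens.
/-- **THM 3 — THE ROOT REGION COUNT IS THE `W`-SIDE COUNT (block model).**  Under `|det(γ₂ − u₀₀·1)| > |ϖ|^{2d₀+1}`, `|u₀₀| = 1` and `|u₀₀ − 1| ≤ |ϖ|^{d₀}`: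
`#{M ∣ SD M ∧ Γ·M = M ∧ (Γ − 1)·M ≤ ϖ^{d₀}·M} = #{B ∣ SD_{H₂} B ∧ γ₂·B = B ∧ (γ₂ − 1)·B ≤ ϖ^{d₀}·B}` (THM 2 ∘ ★ `ncard_selfDual_fixed_axis_lev_eq`) — the `#sR` of
★ `strataCount_J₀_block_raw` at the hyperbolic literal is A-p12's ★ W-ball count. [cite: Kottwitz1986, §3] [cite: BruhatTits1972, §10] [cite: Rogawski1990, §4.9 pp. 54–56] -/
theorem ncard_selfDual_fixed_lev_eq_ncard_two_of_lt_v_det [IsPrincipalIdealRing 𝒪[K]] (σ : K →+* K) (hσ : ∀ a, σ (σ a) = a)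
    (hvσ : ∀ a, Valued.v (σ a) = Valued.v a) {ϖ : K} (hϖ : Valued.v ϖ = WithZero.exp (-1 : ℤ))
    {H₂ : Matrix (Fin 2) (Fin 2) K} (hH₂ : IsUnit H₂.det) (hH₂σ : (H₂.map σ)ᵀ = H₂) {h : K} (hh : Valued.v h = 1) (hhσ : σ h = h)
    (γ₂ : GL (Fin 2) K) (u : GL (Fin 1) K) (hu : Valued.v ((u : Matrix (Fin 1) (Fin 1) K) 0 0) = 1) {d₀ : ℕ}
    (hud : Valued.v ((u : Matrix (Fin 1) (Fin 1) K) 0 0 - 1) ≤ Valued.v (ϖ ^ d₀))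
    (hdet : Valued.v ϖ ^ (2 * d₀ + 1) <
      Valued.v (((γ₂ : Matrix (Fin 2) (Fin 2) K) - (u : Matrix (Fin 1) (Fin 1) K) 0 0 • (1 : Matrix (Fin 2) (Fin 2) K)).det)) :
    {M : Submodule 𝒪[K] (Fin 3 → K) | IsSelfDualLattice σ ϖ (!![H₂ 0 0, 0, H₂ 0 1; 0, h, 0; H₂ 1 0, 0, H₂ 1 1] : Matrix (Fin 3) (Fin 3) K) M ∧
        mapGL (endoGL (γ₂, u)) M = M ∧
        M.map ((Matrix.toLin' (((endoGL (γ₂, u) : GL (Fin 3) K) : Matrix (Fin 3) (Fin 3) K) - 1)).restrictScalars 𝒪[K]) ≤ scaleLattice (ϖ ^ d₀) M}.ncard =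
    {B : Submodule 𝒪[K] (Fin 2 → K) | IsSelfDualLattice σ ϖ H₂ B ∧ mapGL γ₂ B = B ∧
        B.map ((Matrix.toLin' ((γ₂ : Matrix (Fin 2) (Fin 2) K) - 1)).restrictScalars 𝒪[K]) ≤ scaleLattice (ϖ ^ d₀) B}.ncard := by
  have hϖ0' : Valued.v ϖ ≠ 0 := by rw [hϖ]; exact WithZero.exp_ne_zero
  have hϖ0 : ϖ ≠ 0 := fun h0 => by rw [h0, map_zero] at hϖ0'; exact hϖ0' rfl
  have hϖ1 : Valued.v ϖ ≤ 1 := by rw [hϖ, ← WithZero.exp_zero]; exact WithZero.exp_le_exp.2 (by norm_num)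
  rw [setOf_selfDual_fixed_lev_eq_setOf_axis_of_lt_v_det σ hσ hvσ hϖ hH₂ hH₂σ hh hhσ γ₂ u hdet]
  exact ncard_selfDual_fixed_axis_lev_eq σ hvσ hϖ0 hϖ1 hH₂ hh γ₂ hu (pow_ne_zero d₀ hϖ0) hud

set_option maxHeartbeats 1600000 in -- budget only: statement-heavy lattice tokens.
/-- **THM 4 — `Φ₃`-MODEL (J₀-model of ★ `strataCount_J₀_block_raw`), VERTEX FORM.**  For `γ ∈ U(σ, Φ₃)` with matrix `ι(γ₂, u)` (`Φ₃ = ι-shape(Φ₂, 1)`, ★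
`antidiagonal_three_over_eq_endoShape`) and `|det(γ₂ − u₀₀·1)| > |ϖ|^{2d₀+1}`: every vertex `v` of the root region `{v ∣ γ·v = v ∧ SD v.1 ∧ (γ − 1)·v.1 ≤ ϖ^{d₀}·v.1}` (the set of
the head's `hsR`) is an AXIS vertex: `e₁ ∈ v.1`. [cite: Kottwitz1986, §3] [cite: BruhatTits1972, §10] [cite: Rogawski1990, §4.9 pp. 54–56] -/
theorem single_one_one_mem_of_mem_rootRegion_of_coe_eq_endoGL [IsPrincipalIdealRing 𝒪[K]] {σ : K →+* K} {ϖ : K}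
    (hσ : ∀ a, σ (σ a) = a) (hvσ : ∀ a, Valued.v (σ a) = Valued.v a) (hϖ : Valued.v ϖ = WithZero.exp (-1 : ℤ))
    (γ : unitaryGroupOfForm σ ((StdForm.antidiagonal 3).over K)) (γ₂ : GL (Fin 2) K) (u : GL (Fin 1) K) (hγ : (γ : GL (Fin 3) K) = endoGL (γ₂, u)) {d₀ : ℕ}
    (hdet : Valued.v ϖ ^ (2 * d₀ + 1) <
      Valued.v (((γ₂ : Matrix (Fin 2) (Fin 2) K) - (u : Matrix (Fin 1) (Fin 1) K) 0 0 • (1 : Matrix (Fin 2) (Fin 2) K)).det)) :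
    ∀ v : {M : Submodule 𝒪[K] (Fin 3 → K) // IsVertex σ ϖ ((StdForm.antidiagonal 3).over K) M},
      v ∈ {v : {M : Submodule 𝒪[K] (Fin 3 → K) // IsVertex σ ϖ ((StdForm.antidiagonal 3).over K) M} |
        latticeGraphIso σ ϖ ((StdForm.antidiagonal 3).over K) γ v = v ∧ IsSelfDualLattice σ ϖ ((StdForm.antidiagonal 3).over K) v.1 ∧
          v.1.map ((Matrix.toLin' (((γ : GL (Fin 3) K) : Matrix (Fin 3) (Fin 3) K) - 1)).restrictScalars 𝒪[K]) ≤ scaleLattice (ϖ ^ d₀) v.1} →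
      (Pi.single 1 1 : Fin 3 → K) ∈ v.1 := by
  have hH₂ : IsUnit (!![(0 : K), 1; 1, 0] : Matrix (Fin 2) (Fin 2) K).det := by
    rw [Matrix.det_fin_two]; simp
  have hH₂σ : ((!![(0 : K), 1; 1, 0] : Matrix (Fin 2) (Fin 2) K).map σ)ᵀ = !![(0 : K), 1; 1, 0] := by
    ext i j; fin_cases i <;> fin_cases j <;> simp
  rintro v ⟨-, hSD, hlev⟩
  have hSD' : IsSelfDualLattice σ ϖ
      (!![(!![(0 : K), 1; 1, 0] : Matrix (Fin 2) (Fin 2) K) 0 0, 0, (!![(0 : K), 1; 1, 0] : Matrix (Fin 2) (Fin 2) K) 0 1; 0, (1 : K), 0;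
        (!![(0 : K), 1; 1, 0] : Matrix (Fin 2) (Fin 2) K) 1 0, 0, (!![(0 : K), 1; 1, 0] : Matrix (Fin 2) (Fin 2) K) 1 1] : Matrix (Fin 3) (Fin 3) K) v.1 := by
    rw [← antidiagonal_three_over_eq_endoShape]; exact hSD
  rw [hγ] at hlev
  exact single_one_one_mem_of_selfDual_lev_of_lt_v_det σ hσ hvσ hϖ hH₂ hH₂σ (h := 1) (by rw [map_one]) (map_one σ) γ₂ u hdet hSD'
    (forall_mulVec_mem_scaleLattice_of_map_le _ _ _ hlev)

set_option maxHeartbeats 1600000 in -- budget only: statement-heavy lattice tokens.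
/-- **THM 5 — `Φ₃`-MODEL, COUNT FORM**: for `γ ∈ U(σ, Φ₃)` with matrix `ι(γ₂, u)`, `|u₀₀| = 1`, `|u₀₀ − 1| ≤ |ϖ|^{d₀}` and `|det(γ₂ − u₀₀·1)| > |ϖ|^{2d₀+1}`, the root region of the
head's `hsR` has `#{v ∣ γ·v = v ∧ SD v.1 ∧ (γ − 1)·v.1 ≤ ϖ^{d₀}·v.1} = #{B ∣ SD_{Φ₂} B ∧ γ₂·B = B ∧ (γ₂ − 1)·B ≤ ϖ^{d₀}·B}` (`Φ₂ = !![0, 1; 1, 0]`; A-p12's ★ W-ball count after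
`stdForm_antidiagonal_two_over_eq` ∕ `placeForm_antidiagOne`). [cite: Kottwitz1986, §3] [cite: BruhatTits1972, §10] [cite: Rogawski1990, §4.9 pp. 54–56] -/
theorem ncard_rootRegion_eq_ncard_two_of_coe_eq_endoGL [IsPrincipalIdealRing 𝒪[K]] {σ : K →+* K} {ϖ : K}
    (hσ : ∀ a, σ (σ a) = a) (hvσ : ∀ a, Valued.v (σ a) = Valued.v a) (hϖ : Valued.v ϖ = WithZero.exp (-1 : ℤ))
    (γ : unitaryGroupOfForm σ ((StdForm.antidiagonal 3).over K)) (γ₂ : GL (Fin 2) K) (u : GL (Fin 1) K) (hγ : (γ : GL (Fin 3) K) = endoGL (γ₂, u))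
    (hu : Valued.v ((u : Matrix (Fin 1) (Fin 1) K) 0 0) = 1) {d₀ : ℕ} (hud : Valued.v ((u : Matrix (Fin 1) (Fin 1) K) 0 0 - 1) ≤ Valued.v (ϖ ^ d₀))
    (hdet : Valued.v ϖ ^ (2 * d₀ + 1) <
      Valued.v (((γ₂ : Matrix (Fin 2) (Fin 2) K) - (u : Matrix (Fin 1) (Fin 1) K) 0 0 • (1 : Matrix (Fin 2) (Fin 2) K)).det)) :
    {v : {M : Submodule 𝒪[K] (Fin 3 → K) // IsVertex σ ϖ ((StdForm.antidiagonal 3).over K) M} |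
        latticeGraphIso σ ϖ ((StdForm.antidiagonal 3).over K) γ v = v ∧ IsSelfDualLattice σ ϖ ((StdForm.antidiagonal 3).over K) v.1 ∧
          v.1.map ((Matrix.toLin' (((γ : GL (Fin 3) K) : Matrix (Fin 3) (Fin 3) K) - 1)).restrictScalars 𝒪[K]) ≤ scaleLattice (ϖ ^ d₀) v.1}.ncard =
    {B : Submodule 𝒪[K] (Fin 2 → K) | IsSelfDualLattice σ ϖ (!![(0 : K), 1; 1, 0] : Matrix (Fin 2) (Fin 2) K) B ∧ mapGL γ₂ B = B ∧
        B.map ((Matrix.toLin' ((γ₂ : Matrix (Fin 2) (Fin 2) K) - 1)).restrictScalars 𝒪[K]) ≤ scaleLattice (ϖ ^ d₀) B}.ncard := by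
  have hH₂ : IsUnit (!![(0 : K), 1; 1, 0] : Matrix (Fin 2) (Fin 2) K).det := by
    rw [Matrix.det_fin_two]; simp
  have hH₂σ : ((!![(0 : K), 1; 1, 0] : Matrix (Fin 2) (Fin 2) K).map σ)ᵀ = !![(0 : K), 1; 1, 0] := by
    ext i j; fin_cases i <;> fin_cases j <;> simp
  rw [← ncard_selfDual_fixed_lev_eq_ncard_two_of_lt_v_det σ hσ hvσ hϖ hH₂ hH₂σ (h := 1) (by rw [map_one]) (map_one σ) γ₂ u hu hud hdet,
    ← antidiagonal_three_over_eq_endoShape, ← hγ]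
  -- the vertex set is the image-free copy of the lattice set under `v ↦ v.1`
  have himg : (Subtype.val '' {v : {M : Submodule 𝒪[K] (Fin 3 → K) // IsVertex σ ϖ ((StdForm.antidiagonal 3).over K) M} |
        latticeGraphIso σ ϖ ((StdForm.antidiagonal 3).over K) γ v = v ∧ IsSelfDualLattice σ ϖ ((StdForm.antidiagonal 3).over K) v.1 ∧
          v.1.map ((Matrix.toLin' (((γ : GL (Fin 3) K) : Matrix (Fin 3) (Fin 3) K) - 1)).restrictScalars 𝒪[K]) ≤ scaleLattice (ϖ ^ d₀) v.1}) =
      {M : Submodule 𝒪[K] (Fin 3 → K) | IsSelfDualLattice σ ϖ ((StdForm.antidiagonal 3).over K) M ∧ mapGL (γ : GL (Fin 3) K) M = M ∧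
        M.map ((Matrix.toLin' (((γ : GL (Fin 3) K) : Matrix (Fin 3) (Fin 3) K) - 1)).restrictScalars 𝒪[K]) ≤ scaleLattice (ϖ ^ d₀) M} := by
    ext M
    simp only [Set.mem_image, Set.mem_setOf_eq]
    constructor
    · rintro ⟨v, ⟨hfix, hSD, hlev⟩, rfl⟩
      refine ⟨hSD, ?_, hlev⟩
      have e := congrArg Subtype.val hfix
      rw [latticeGraphIso_apply_coe] at e
      exact e
    · rintro ⟨hSD, hfix, hlev⟩
      refine ⟨⟨M, 0, hSD⟩, ⟨?_, hSD, hlev⟩, rfl⟩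
      apply Subtype.ext
      rw [latticeGraphIso_apply_coe]
      exact hfix
  rw [← himg, Set.ncard_image_of_injective _ Subtype.val_injective]

end Literature.NumberTheory.Automorphic.UnitaryLatticeTree

end
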